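import Mathlib
import Summits.CriticalPhenomena.PercolationContinuityZ3.Theorems.PercNearOneGluingNoHeavyLowerTailTNKernels
import Summits.CriticalPhenomena.PercolationContinuityZ3.Theorems.PercNearOneGluingNoHeavyLowerTailBandTwoTN
import HarnessLib

/-!
# Column-banded kernels and two integer copies at `λ = 0` (THEOREM 2₀)

Support file for the Sahi / Conjecture-P programme of route `PercNearOneGluingNoHeavy`
(`--supports stmt-CriticalPhenomena-4575`, prover prim-l12-p5 gen 45; proof note
`prim-l12-p5/PROOF-INTEGER-COPIES-g45.md` §1 and §4.2).  No definitions, no named facts, no sorries.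

For `T` integer copies the exp-arrays of the programme are `F_s = (TP kernel) ∘ (t,l) ↦ t^l R(t,l)`, and the
`t`-coefficient matrix of the polynomial family `{t^l R(t,l)}_l` is the **column-banded** matrix
`𝒪₀(n,l) = [t^{n-l}] R(t,l)`: entry `d_i(l)` at position `(l+i, l)`, `0 ≤ i ≤ T`, the bands being indexed by the
COLUMN (memo §1; this is the `λ = 0` member of gen 33's `λ`-family, the strongest one: the family is an up-set
in `λ`).  For `T = 2`:
`d_0(l) = m(m-1) + m(g_1+g_2) l + g_1 g_2 l(l-1)`, `d_1(l) = b_1(m + g_2 l) + b_2(m + g_1 l)`, `d_2(l) = b_1 b_2`.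

**THEOREM (`colBand_tn`, abstract).**  If `d_0, d_1 > 0`, `d_2 ≥ 0` and `4 d_0(l+1) d_2(l) ≤ d_1(l) d_1(l+1)` for all
`l`, then the column-banded kernel `K(n,l) = [n = l] d_0(l) + [n = l+1] d_1(l) + [n = l+2] d_2(l)` is totally
nonnegative.  Proof: the continued fraction `W_0 = d_1(0)`, `W_{l+1} = d_1(l+1) - d_2(l) d_0(l+1)/W_l` stays
`≥ d_1/2` (chain bound `1/4`), and `K = 𝔅 · 𝔙` with `𝔅 = bidiag(1 ; d_2(n-2)/W_{n-2})` and
`𝔙 = bidiag(d_0(n) ; W_{n-1})`, both nonnegative lower bidiagonal (`BandTwoTN.bidiag_minor_nonneg`,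
`TNKernel.mulLower_minor_nonneg`).

**THEOREM 2₀ (`integerPair_tn`).**  For `b_1, b_2 > 0`, `0 < g_1, g_2 ≤ 1`, `m > 1` the matrix `𝒪₀` of two
sub-neutral integer copies is totally nonnegative.  The chain inequality is gen 33's shifted Rayleigh
identities `Q_1(l+1)Q_2(l) - Q_{12}(l+1) = m(1-g_2)`, `Q_1(l)Q_2(l+1) - Q_{12}(l+1) = m(1-g_1)` plus AM–GM.
(This contains THEOREM A′ of gen 33 for sub-neutral pairs, which is the statement at `λ = b_1/g_1`.)
-/

namespace Summit.CriticalPhenomena.PercolationContinuityZ3.Theorems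

namespace IntegerPairTN

open Finset Matrix

/-- **Column-banded chain criterion.**  `d_0, d_1 > 0`, `d_2 ≥ 0`, `4 d_0(l+1) d_2(l) ≤ d_1(l) d_1(l+1)` ⟹ the
kernel `[n = l] d_0(l) + [n = l+1] d_1(l) + [n = l+2] d_2(l)` is totally nonnegative. -/
theorem colBand_tn (d0 d1 d2 : ℕ → ℝ) (hd0 : ∀ l, 0 < d0 l) (hd1 : ∀ l, 0 < d1 l) (hd2 : ∀ l, 0 ≤ d2 l)
    (hchain : ∀ l, 4 * (d0 (l + 1) * d2 l) ≤ d1 l * d1 (l + 1))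
    {k : ℕ} (r c : Fin k → ℕ) (hr : StrictMono r) (hc : StrictMono c) :
    0 ≤ (Matrix.of fun i j => (if r i = c j then d0 (c j) else if r i = c j + 1 then d1 (c j)
      else if r i = c j + 2 then d2 (c j) else 0)).det := by
  -- the continued fraction W
  let W : ℕ → ℝ := fun n => Nat.rec (motive := fun _ => ℝ) (d1 0)
    (fun l w => d1 (l + 1) - d2 l * d0 (l + 1) / w) n
  have hW0 : W 0 = d1 0 := rfl
  have hWs : ∀ l, W (l + 1) = d1 (l + 1) - d2 l * d0 (l + 1) / W l := fun l => rfl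
  have hWlb : ∀ l, d1 l / 2 ≤ W l := by
    intro l
    induction l with
    | zero => rw [hW0]; linarith [hd1 0]
    | succ l ih =>
      have h1l := hd1 l; have h1s := hd1 (l + 1); have h0s := hd0 (l + 1); have h2l := hd2 l
      have hWpos : 0 < W l := lt_of_lt_of_le (by positivity) ih
      have hcl := hchain l
      rw [hWs l]
      -- d2 l * d0 (l+1) / W l ≤ d2 l * d0 (l+1) / (d1 l / 2) ≤ d1 (l+1) / 2
      have e1 : d2 l * d0 (l + 1) / W l ≤ d2 l * d0 (l + 1) / (d1 l / 2) :=
        div_le_div_of_nonneg_left (by positivity) (by positivity) ih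
      have e2 : d2 l * d0 (l + 1) / (d1 l / 2) ≤ d1 (l + 1) / 2 := by
        rw [div_le_div_iff₀ (by positivity) two_pos]
        nlinarith
      linarith
  have hWpos : ∀ l, 0 < W l := fun l => lt_of_lt_of_le (div_pos (hd1 l) two_pos) (hWlb l)
  -- the left factor 𝔅 = bidiag(1 ; q), q n = d2(n-2)/W(n-2) for n ≥ 2
  let q : ℕ → ℝ := fun n => if 2 ≤ n then d2 (n - 2) / W (n - 2) else 0
  have hq0 : q 0 = 0 := by show (if 2 ≤ 0 then _ else _) = (0 : ℝ); rw [if_neg (by omega)]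
  have hq1 : q 1 = 0 := by show (if 2 ≤ 1 then _ else _) = (0 : ℝ); rw [if_neg (by omega)]
  have hq2 : ∀ l, q (l + 2) = d2 l / W l := by
    intro l; show (if 2 ≤ l + 2 then d2 (l + 2 - 2) / W (l + 2 - 2) else 0) = d2 l / W l
    rw [if_pos (by omega), Nat.add_sub_cancel]
  have hqnn : ∀ n, 0 ≤ q n := by
    intro n
    rcases Nat.lt_or_ge n 2 with h | h
    · interval_cases n
      · rw [hq0]
      · rw [hq1]
    · obtain ⟨l, rfl⟩ : ∃ l, n = l + 2 := ⟨n - 2, by omega⟩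
      rw [hq2]; exact div_nonneg (hd2 l) (hWpos l).le
  -- the right factor 𝔙 = bidiag(d0 ; W(·-1)) (row-indexed: 𝔙(t,l) = [l = t] d0 t + [l+1 = t] W(t-1))
  let V : ℕ → ℕ → ℝ := fun t l => if l = t then d0 t else if l + 1 = t then W (t - 1) else 0
  -- K(n,l) = Σ_t 𝔅(n,t) 𝔙(t,l)
  have hrow : ∀ n l : ℕ, (if n = l then d0 l else if n = l + 1 then d1 l else if n = l + 2 then d2 l else 0)
      = ∑ t ∈ range (n + 1), (if t = n then (1 : ℝ) else if t + 1 = n then q n else 0) * V t l := by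
    intro n l
    rw [BandTwoTN.sum_bidiag (fun _ => (1 : ℝ)) q (fun t => V t l) hq0 n, one_mul]
    rcases (show n < l ∨ n = l ∨ n = l + 1 ∨ n = l + 2 ∨ l + 3 ≤ n by omega) with h | h | h | h | h
    · -- n < l: everything vanishes
      have hV1 : V n l = 0 := by
        show (if l = n then d0 n else if l + 1 = n then W (n - 1) else 0) = 0
        rw [if_neg (by omega), if_neg (by omega)]
      have hV2 : q n * V (n - 1) l = 0 := by
        rcases Nat.lt_or_ge n 2 with hn | hn
        · interval_cases n
          · rw [hq0, zero_mul]
          · rw [hq1, zero_mul]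
        · have : V (n - 1) l = 0 := by
            show (if l = n - 1 then d0 (n - 1) else if l + 1 = n - 1 then W (n - 1 - 1) else 0) = 0
            rw [if_neg (by omega), if_neg (by omega)]
          rw [this, mul_zero]
      rw [if_neg (by omega), if_neg (by omega), if_neg (by omega), hV1, hV2, add_zero]
    · -- n = l
      subst h
      have hV1 : V n n = d0 n := by
        show (if n = n then d0 n else if n + 1 = n then W (n - 1) else 0) = d0 n; rw [if_pos rfl]
      have hV2 : q n * V (n - 1) n = 0 := by
        rcases Nat.lt_or_ge n 2 with hn | hn
        · interval_cases n
          · rw [hq0, zero_mul]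
          · rw [hq1, zero_mul]
        · have : V (n - 1) n = 0 := by
            show (if n = n - 1 then d0 (n - 1) else if n + 1 = n - 1 then W (n - 1 - 1) else 0) = 0
            rw [if_neg (by omega), if_neg (by omega)]
          rw [this, mul_zero]
      rw [if_pos rfl, hV1, hV2, add_zero]
    · -- n = l + 1
      subst h
      have hV1 : V (l + 1) l = W l := by
        show (if l = l + 1 then d0 (l + 1) else if l + 1 = l + 1 then W (l + 1 - 1) else 0) = W l
        rw [if_neg (by omega), if_pos rfl, Nat.add_sub_cancel]
      have hV2 : V (l + 1 - 1) l = d0 l := by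
        rw [Nat.add_sub_cancel]
        show (if l = l then d0 l else if l + 1 = l then W (l - 1) else 0) = d0 l; rw [if_pos rfl]
      rw [if_neg (by omega), if_pos rfl, hV1, hV2]
      rcases Nat.eq_zero_or_pos l with hl | hl
      · subst hl; rw [hq1, hW0]; ring
      · obtain ⟨l', rfl⟩ : ∃ l', l = l' + 1 := ⟨l - 1, by omega⟩
        rw [hq2 l', hWs l']
        have hWne : W l' ≠ 0 := (hWpos l').ne'
        field_simp
        ring
    · -- n = l + 2
      subst h
      have hV1 : V (l + 2) l = 0 := by
        show (if l = l + 2 then d0 (l + 2) else if l + 1 = l + 2 then W (l + 2 - 1) else 0) = 0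
        rw [if_neg (by omega), if_neg (by omega)]
      have hV2 : V (l + 2 - 1) l = W l := by
        rw [show l + 2 - 1 = l + 1 by omega]
        show (if l = l + 1 then d0 (l + 1) else if l + 1 = l + 1 then W (l + 1 - 1) else 0) = W l
        rw [if_neg (by omega), if_pos rfl, Nat.add_sub_cancel]
      rw [if_neg (by omega), if_neg (by omega), if_pos rfl, hV1, hV2, hq2 l, zero_add]
      exact (div_mul_cancel₀ _ (hWpos l).ne').symm
    · -- n ≥ l + 3
      obtain ⟨e, rfl⟩ : ∃ e, n = l + 3 + e := ⟨n - (l + 3), by omega⟩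
      have hV1 : V (l + 3 + e) l = 0 := by
        show (if l = l + 3 + e then d0 (l + 3 + e) else if l + 1 = l + 3 + e then W (l + 3 + e - 1) else 0) = 0
        rw [if_neg (by omega), if_neg (by omega)]
      have hV2 : V (l + 3 + e - 1) l = 0 := by
        show (if l = l + 3 + e - 1 then d0 (l + 3 + e - 1)
          else if l + 1 = l + 3 + e - 1 then W (l + 3 + e - 1 - 1) else 0) = 0
        rw [if_neg (by omega), if_neg (by omega)]
      rw [if_neg (by omega), if_neg (by omega), if_neg (by omega), hV1, hV2, mul_zero, add_zero]
  have heq : (Matrix.of fun i j => (if r i = c j then d0 (c j) else if r i = c j + 1 then d1 (c j)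
      else if r i = c j + 2 then d2 (c j) else 0)) =
      Matrix.of fun i j => ∑ t ∈ range (r i + 1),
        (if t = r i then (1 : ℝ) else if t + 1 = r i then q (r i) else 0) * V t (c j) := by
    ext i j
    rw [Matrix.of_apply, Matrix.of_apply, hrow]
  rw [heq]
  set N := (univ.sup r) + (univ.sup c) + 1 with hN
  refine TNKernel.mulLower_minor_nonneg
    (fun n t => if t = n then (1 : ℝ) else if t + 1 = n then q n else 0)
    V N ?_ ?_ ?_ r c hr hc (fun i => ?_) (fun j => ?_)
  · intro k' r' c' hr' hc'
    exact BandTwoTN.bidiag_minor_nonneg (fun _ => (1 : ℝ)) q (fun _ => one_pos) hqnn r' c' hr' hc'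
  · intro k' r' c' hr' hc' _ _
    have hV : (Matrix.of fun i j => V (r' i) (c' j)) =
        Matrix.of fun i j => (if c' j = r' i then d0 (r' i) else if c' j + 1 = r' i then W (r' i - 1) else 0) := by
      ext i j; rfl
    rw [hV]
    exact BandTwoTN.bidiag_minor_nonneg d0 (fun t => W (t - 1)) hd0 (fun t => (hWpos (t - 1)).le)
      r' c' hr' hc'
  · intro n t hnt
    rw [if_neg (by omega), if_neg (by omega)]
  · have : r i ≤ univ.sup r := Finset.le_sup (f := r) (mem_univ i)
    omega
  · have : c j ≤ univ.sup c := Finset.le_sup (f := c) (mem_univ j)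
    omega

/-- AM–GM in the form used for the chain bound: `C² ≤ A B` with `A, B, β₁, β₂ ≥ 0` gives
`2 β₁ β₂ C ≤ β₁² A + β₂² B`. -/
theorem two_mul_le_sq_add_sq (A B C β₁ β₂ : ℝ) (hA : 0 ≤ A) (hB : 0 ≤ B)
    (hβ₁ : 0 ≤ β₁) (hβ₂ : 0 ≤ β₂) (h : C ^ 2 ≤ A * B) :
    2 * β₁ * β₂ * C ≤ β₁ ^ 2 * A + β₂ ^ 2 * B := by
  have hsA := Real.sq_sqrt hA
  have hsB := Real.sq_sqrt hB
  have ha := Real.sqrt_nonneg A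
  have hb := Real.sqrt_nonneg B
  have h2 : C ^ 2 ≤ (Real.sqrt A * Real.sqrt B) ^ 2 := by rw [mul_pow, hsA, hsB]; exact h
  have hC' : C ≤ Real.sqrt A * Real.sqrt B :=
    calc C ≤ |C| := le_abs_self C
      _ ≤ |Real.sqrt A * Real.sqrt B| := sq_le_sq.mp h2
      _ = Real.sqrt A * Real.sqrt B := abs_of_nonneg (mul_nonneg ha hb)
  have h3 : 2 * β₁ * β₂ * (Real.sqrt A * Real.sqrt B) ≤ β₁ ^ 2 * A + β₂ ^ 2 * B := by
    have e : β₁ ^ 2 * A + β₂ ^ 2 * B - 2 * β₁ * β₂ * (Real.sqrt A * Real.sqrt B)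
        = (β₁ * Real.sqrt A - β₂ * Real.sqrt B) ^ 2 := by
      rw [sub_sq, mul_pow, mul_pow, hsA, hsB]; ring
    nlinarith [sq_nonneg (β₁ * Real.sqrt A - β₂ * Real.sqrt B)]
  have h4 : 2 * β₁ * β₂ * C ≤ 2 * β₁ * β₂ * (Real.sqrt A * Real.sqrt B) :=
    mul_le_mul_of_nonneg_left hC' (by positivity)
  linarith

/-- **THEOREM 2₀ (two sub-neutral integer copies at `λ = 0`).**  For `b_1, b_2 > 0`, `0 < g_1, g_2 ≤ 1`, `m > 1`
the column-banded matrix `𝒪₀` with bands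
`d_0(l) = m(m-1) + m(g_1+g_2) l + g_1 g_2 l (l-1)`, `d_1(l) = b_1 (m + g_2 l) + b_2 (m + g_1 l)`, `d_2(l) = b_1 b_2`
is totally nonnegative. -/
theorem integerPair_tn (b₁ b₂ g₁ g₂ m : ℝ) (hb₁ : 0 < b₁) (hb₂ : 0 < b₂) (hg₁ : 0 < g₁) (hg₁' : g₁ ≤ 1)
    (hg₂ : 0 < g₂) (hg₂' : g₂ ≤ 1) (hm : 1 < m)
    {k : ℕ} (r c : Fin k → ℕ) (hr : StrictMono r) (hc : StrictMono c) :
    0 ≤ (Matrix.of fun i j =>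
      (if r i = c j then m * (m - 1) + m * (g₁ + g₂) * (c j : ℝ) + g₁ * g₂ * (c j : ℝ) * ((c j : ℝ) - 1)
       else if r i = c j + 1 then b₁ * (m + g₂ * (c j : ℝ)) + b₂ * (m + g₁ * (c j : ℝ))
       else if r i = c j + 2 then b₁ * b₂ else 0)).det := by
  have hm0 : 0 < m := by linarith
  have hll : ∀ l : ℕ, (0 : ℝ) ≤ (l : ℝ) * ((l : ℝ) - 1) := by
    intro l
    rcases Nat.eq_zero_or_pos l with rfl | hl
    · simp
    · have : (1 : ℝ) ≤ (l : ℝ) := by exact_mod_cast hl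
      nlinarith
  have hd0pos : ∀ l : ℕ, 0 < m * (m - 1) + m * (g₁ + g₂) * (l : ℝ) + g₁ * g₂ * (l : ℝ) * ((l : ℝ) - 1) := by
    intro l
    have h1 : 0 < m * (m - 1) := by nlinarith
    have h2 : 0 ≤ m * (g₁ + g₂) * (l : ℝ) := by positivity
    have h3 : 0 ≤ g₁ * g₂ * (l : ℝ) * ((l : ℝ) - 1) := by
      rw [mul_assoc (g₁ * g₂)]; exact mul_nonneg (by positivity) (hll l)
    linarith
  have hd1pos : ∀ l : ℕ, 0 < b₁ * (m + g₂ * (l : ℝ)) + b₂ * (m + g₁ * (l : ℝ)) := by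
    intro l; positivity
  -- the chain inequality 4 d0(l+1) d2(l) ≤ d1(l) d1(l+1): shifted Rayleigh identities + AM–GM
  have hchain : ∀ l : ℕ,
      4 * ((m * (m - 1) + m * (g₁ + g₂) * ((l + 1 : ℕ) : ℝ)
        + g₁ * g₂ * ((l + 1 : ℕ) : ℝ) * (((l + 1 : ℕ) : ℝ) - 1)) * (b₁ * b₂))
      ≤ (b₁ * (m + g₂ * (l : ℝ)) + b₂ * (m + g₁ * (l : ℝ)))
        * (b₁ * (m + g₂ * ((l + 1 : ℕ) : ℝ)) + b₂ * (m + g₁ * ((l + 1 : ℕ) : ℝ))) := by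
    intro l
    have hQpos := hd0pos (l + 1)
    push_cast at hQpos ⊢
    set x : ℝ := (l : ℝ) with hx
    have hx0 : 0 ≤ x := by positivity
    -- Q = Q_{12}(l+1), A = Q_2(l)Q_2(l+1), B = Q_1(l)Q_1(l+1)
    set Q : ℝ := m * (m - 1) + m * (g₁ + g₂) * (x + 1) + g₁ * g₂ * (x + 1) * (x + 1 - 1) with hQ
    set A : ℝ := (m + g₂ * x) * (m + g₂ * (x + 1)) with hA
    set B : ℝ := (m + g₁ * x) * (m + g₁ * (x + 1)) with hB
    have hQnn : 0 ≤ Q := hQpos.le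
    have hAnn : 0 ≤ A := by rw [hA]; positivity
    have hBnn : 0 ≤ B := by rw [hB]; positivity
    have h1 : 0 ≤ m * (1 - g₁) := mul_nonneg hm0.le (by linarith)
    have h2 : 0 ≤ m * (1 - g₂) := mul_nonneg hm0.le (by linarith)
    -- shifted Rayleigh identities (gen 33 (4.1))
    have hR1 : (m + g₁ * (x + 1)) * (m + g₂ * x) = Q + m * (1 - g₂) := by rw [hQ]; ring
    have hR2 : (m + g₁ * x) * (m + g₂ * (x + 1)) = Q + m * (1 - g₁) := by rw [hQ]; ring
    have hAB : Q ^ 2 ≤ A * B := by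
      have hprod : A * B = Q ^ 2 + (Q * (m * (1 - g₂)) + Q * (m * (1 - g₁)) + m * (1 - g₂) * (m * (1 - g₁))) := by
        have : A * B = ((m + g₁ * (x + 1)) * (m + g₂ * x)) * ((m + g₁ * x) * (m + g₂ * (x + 1))) := by
          rw [hA, hB]; ring
        rw [this, hR1, hR2]; ring
      rw [hprod]
      have := mul_nonneg hQnn h2; have := mul_nonneg hQnn h1; have := mul_nonneg h2 h1
      linarith
    have hamgm := two_mul_le_sq_add_sq A B Q b₁ b₂ hAnn hBnn hb₁.le hb₂.le hAB
    have hexp : (b₁ * (m + g₂ * x) + b₂ * (m + g₁ * x)) * (b₁ * (m + g₂ * (x + 1)) + b₂ * (m + g₁ * (x + 1)))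
        = b₁ ^ 2 * A + b₂ ^ 2 * B + 2 * (b₁ * b₂ * Q) + b₁ * b₂ * (m * (1 - g₁) + m * (1 - g₂)) := by
      have e1 : (b₁ * (m + g₂ * x) + b₂ * (m + g₁ * x)) * (b₁ * (m + g₂ * (x + 1)) + b₂ * (m + g₁ * (x + 1)))
          = b₁ ^ 2 * ((m + g₂ * x) * (m + g₂ * (x + 1))) + b₂ ^ 2 * ((m + g₁ * x) * (m + g₁ * (x + 1)))
            + b₁ * b₂ * (((m + g₁ * (x + 1)) * (m + g₂ * x)) + ((m + g₁ * x) * (m + g₂ * (x + 1)))) := by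
        ring
      rw [e1, hR1, hR2, ← hA, ← hB]; ring
    have hlhs : 4 * (Q * (b₁ * b₂)) = 2 * (b₁ * b₂ * Q) + 2 * (b₁ * b₂ * Q) := by ring
    have h3 : 0 ≤ b₁ * b₂ * (m * (1 - g₁) + m * (1 - g₂)) :=
      mul_nonneg (mul_nonneg hb₁.le hb₂.le) (by linarith)
    have h6 : 2 * (b₁ * b₂ * Q) ≤ b₁ ^ 2 * A + b₂ ^ 2 * B := by linarith [hamgm]
    rw [hexp, hlhs]
    linarith
  exact colBand_tn (fun l : ℕ => m * (m - 1) + m * (g₁ + g₂) * (l : ℝ) + g₁ * g₂ * (l : ℝ) * ((l : ℝ) - 1))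
    (fun l : ℕ => b₁ * (m + g₂ * (l : ℝ)) + b₂ * (m + g₁ * (l : ℝ))) (fun _ => b₁ * b₂)
    hd0pos hd1pos (fun _ => (mul_pos hb₁ hb₂).le) hchain r c hr hc

end IntegerPairTN

end Summit.CriticalPhenomena.PercolationContinuityZ3.Theorems
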